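import Summits.QuantumFields.QCD.Theorems.QuarksAsStableActionStableActionBridgeProjChainDet
import Summits.QuantumFields.QCD.Theorems.QuarksAsStableActionStableActionBridgeSupertrace
import Summits.QuantumFields.QCD.Theorems.QuarksAsStableActionStableActionBridgeFermionSliceOpCovariance
import Summits.QuantumFields.QCD.Theorems.HeatSlicedQuarksRobustYangMillsHandoverStubOneStepPathHasDerivAt
import Summits.QuantumFields.QCD.Theorems.HeatSlicedQuarksRobustYangMillsHandoverStubGammaPathHasDerivAt
import Summits.QuantumFields.QCD.Theorems.HeatSlicedQuarksRobustYangMillsHandoverStubSupertraceProdHasDerivAt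
import HarnessLib

/-!
# Stub `stub_projChain_det_hasDerivAt_source` of line `pin-the-infimum` (crux `RobustYangMillsHandover`, 8892)

E2, layer F1 (wave 3) of the fermionic-insertion bricks in Lüscher's transfer-matrix representation of
the QCD torus functional: **the one-slice source-derivative formula for a Wilson-type projector chain
with general slice operators.**  A quark bilinear `ψ̄Jψ` at time slice `t₀` is the `s`-derivative at `0`
of the fermion determinant of the chain whose slice operator at `t₀` is `A_{t₀} − sJ`.  By the
time-slice reduction `det_projChain` (general slice operators),
`det D(s) = ∏_t det E_t(s) · det (1 − (−1)^T ∏_i E_i(s)⁻¹F_i(s))`, `E_t = A_tP⁻ − P⁺W′_{t−1}`,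
`F_t = A_tP⁺ − P⁻W_t`, and only the `t₀` data move: `E(s) = E − s JP⁻`, `F(s) = F − s JP⁺`,
`N(s) = −E(s)⁻¹F(s)`.  Writing the second factor as the supertrace `STr ∏_i Γ(N_i)` of the ordered
product of second-quantised one-step matrices and differentiating at `s = 0`:

* `d det E(s) = −det E · tr (E⁻¹JP⁻)` (Jacobi, `StubMatrixAffinePathCalculus`);
* `N′ = −E⁻¹(JP⁻)E⁻¹F + E⁻¹(JP⁺)` (`StubOneStepPathHasDerivAt`), and
  `N′N⁻¹ = E⁻¹J(P⁻ − P⁺F⁻¹E)` since `N⁻¹ = −F⁻¹E`;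
* `d Γ(N(s)) = dΓ(N′N⁻¹) Γ(N)` (`StubGammaPathHasDerivAt`, the `dΓ`-on-the-left form);
* the supertrace of an ordered product with one moving factor (`StubSupertraceProdHasDerivAt`).

Result: `d/ds|₀ det D(s) = (∏_t det E_t) · STr ∏_i (𝒥_i Γ(N_i))` with `𝒥_i = 1` for `i ≠ t₀` and
`𝒥_{t₀} = dΓ(E⁻¹J(P⁻ − P⁺F⁻¹E)) − tr (E⁻¹JP⁻) · 1`; all one-particle matrices are carried to the
Fock index `Fin d` by the algebra isomorphism `Matrix.reindex e e`.

The generic bookkeeping (sign of the ordered product, `Γ ∘ reindex` through a list product, the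
supertrace form of `det (1 − (−1)^T ∏ Y_i)`, two-sided linearity of an ordered product in one slot,
the algebra `N′N⁻¹`) is in the sub-namespace `StubProjChainDetHasDerivAtSource`.

References: M. Lüscher, *Construction of a selfadjoint, strictly positive transfer matrix for
Euclidean lattice gauge theories*, Comm. Math. Phys. 54 (1977) 283, pp. 283–292 [Luscher1977];
J. Smit, *Introduction to Quantum Fields on a Lattice*, §6.5 and App. C; I. Montvay, G. Münster,
*Quantum Fields on a Lattice*, §4.2.3.  Pure theorem file (no definitions).
-/

open Matrix Literature.MathematicalPhysics.QuantumLattice Literature.MathematicalPhysics.QuantumFieldTheory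

namespace Summit.QuantumFields.QCD.Cruxes.RobustYangMillsHandover.PinTheInfimum

open Summit.QuantumFields.QCD.Cruxes.StableActionBridge.Sketch

namespace StubProjChainDetHasDerivAtSource

variable {m n : Type*} [Fintype m] [DecidableEq m] [LinearOrder n] [Fintype n]

/-- `∏_{i ∈ l} (−Y_i) = (−1)^{|l|} · ∏_{i ∈ l} Y_i` for an ordered product of matrices
(cf. `WilsonTransfer.prod_map_neg_eq_smul`). [folklore] -/
theorem prod_map_neg_eq_smul (Y : ℕ → Matrix m m ℂ) :
    ∀ l : List ℕ, (l.map fun i => -Y i).prod = (-1 : ℂ) ^ l.length • (l.map Y).prod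
  | [] => by simp
  | a :: l => by
    rw [List.map_cons, List.prod_cons, prod_map_neg_eq_smul Y l, List.map_cons, List.prod_cons,
      List.length_cons, Matrix.mul_smul, neg_mul, smul_neg, pow_succ, mul_neg_one, neg_smul]

/-- `Γ ∘ reindex e e` passes through an ordered list product (both are multiplicative and unital).
[folklore] -/
theorem prod_map_Gamma_reindex (e : m ≃ n) (Y : ℕ → Matrix m m ℂ) :
    ∀ l : List ℕ, (l.map fun i => Gamma (Matrix.reindex e e (Y i))).prod =
      Gamma (Matrix.reindex e e (l.map Y).prod)
  | [] => by
    rw [List.map_nil, List.prod_nil, List.map_nil, List.prod_nil, Matrix.reindex_apply,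
      Matrix.submatrix_one_equiv, Gamma_one]
  | a :: l => by
    rw [List.map_cons, List.prod_cons, prod_map_Gamma_reindex e Y l, List.map_cons, List.prod_cons,
      FermionSliceOpCovariance.reindex_mul_reindex, Gamma_mul]

/-- The supertrace formula for `Gamma`: `det (1 − X) = Σ_S (−1)^{#S} Γ(X)_{SS}`. [folklore] -/
theorem det_one_sub_eq_supertrace_Gamma (X : Matrix n n ℂ) :
    (1 - X).det = ∑ S : Finset n, (-1 : ℂ) ^ S.card * Gamma X S S := by
  rw [Supertrace.det_one_sub_eq_supertrace_fockLift', FockLiftPosDef.fockLift_eq_Gamma']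

/-- **Supertrace form of the second factor of `det_projChain`**:
`det (1 − (−1)^T ∏_{i<T} Y_i) = Σ_S (−1)^{#S} ⟨S| ∏_{i<T} Γ(reindex (−Y_i)) |S⟩` — the sign is
absorbed into the factors, `det (1 − P) = det (1 − reindex P)`, the supertrace formula, and
multiplicativity of `Γ ∘ reindex`. [folklore] -/
theorem det_one_sub_smul_prod (e : m ≃ n) (Y : ℕ → Matrix m m ℂ) (T : ℕ) :
    (1 - (-1 : ℂ) ^ T • ((List.range T).map Y).prod).det =
      ∑ S : Finset n, (-1 : ℂ) ^ S.card *
        ((List.range T).map fun i => Gamma (Matrix.reindex e e (-Y i))).prod S S := by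
  have h1 : (1 : Matrix n n ℂ) - Matrix.reindex e e ((List.range T).map fun i => -Y i).prod =
      Matrix.reindex e e (1 - ((List.range T).map fun i => -Y i).prod) := by
    simp only [← Matrix.coe_reindexAlgEquiv ℂ ℂ e, map_sub, map_one]
  have h2 : (-1 : ℂ) ^ T • ((List.range T).map Y).prod = ((List.range T).map fun i => -Y i).prod := by
    rw [prod_map_neg_eq_smul Y, List.length_range]
  rw [h2, prod_map_Gamma_reindex e (fun i => -Y i), ← det_one_sub_eq_supertrace_Gamma, h1,
    Matrix.det_reindex_self]

/-- **An ordered product is two-sided linear in each slot**: for `t₀ < T` there are `L, R` with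
`∏_{i<T} (if i = t₀ then X else M i) = L X R` for every `X`. [folklore] -/
theorem exists_prod_map_ite_eq {α : Type*} [Monoid α] (M : ℕ → α) {t₀ : ℕ} :
    ∀ {T : ℕ}, t₀ < T → ∃ L R : α, ∀ X : α,
      ((List.range T).map fun i : ℕ => if i = t₀ then X else M i).prod = L * X * R
  | 0, h => absurd h (Nat.not_lt_zero _)
  | T + 1, h => by
    rcases Nat.lt_or_eq_of_le (Nat.le_of_lt_succ h) with hlt | heq
    · obtain ⟨L, R, hLR⟩ := exists_prod_map_ite_eq M hlt
      exact ⟨L, R * M T, fun X => by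
        rw [StubSupertraceProdHasDerivAt.prod_map_range_succ_of_ne M (Nat.ne_of_gt hlt), hLR, mul_assoc]⟩
    · subst heq
      exact ⟨((List.range t₀).map M).prod, 1, fun X => by
        rw [StubSupertraceProdHasDerivAt.prod_map_range_succ_self, mul_one]⟩

omit [LinearOrder n] in
/-- The supertrace `X ↦ Σ_S (−1)^{#S} X_{SS}` is linear: `STr (A − c B) = STr A − c STr B`.
[folklore] -/
theorem supertrace_sub_smul (A B : Matrix (Finset n) (Finset n) ℂ) (c : ℂ) :
    ∑ S : Finset n, (-1 : ℂ) ^ S.card * (A - c • B) S S =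
      ∑ S : Finset n, (-1 : ℂ) ^ S.card * A S S - c * ∑ S : Finset n, (-1 : ℂ) ^ S.card * B S S := by
  rw [Finset.mul_sum, ← Finset.sum_sub_distrib]
  refine Finset.sum_congr rfl fun S _ => ?_
  rw [Matrix.sub_apply, Matrix.smul_apply, smul_eq_mul]
  ring

/-- `det (−E⁻¹F)` is a unit when `det E` and `det F` are. [folklore] -/
theorem isUnit_det_neg_inv_mul {E F : Matrix m m ℂ} (hE : IsUnit E.det) (hF : IsUnit F.det) :
    IsUnit (-(E⁻¹ * F)).det := by
  rw [Matrix.det_neg, Matrix.det_mul]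
  exact (isUnit_one.neg.pow _).mul ((Matrix.isUnit_nonsing_inv_det E hE).mul hF)

/-- **`N′N⁻¹` for the one-step matrix `N = −E⁻¹F`**: with `N′ = −E⁻¹K₁E⁻¹F + E⁻¹K₂` and
`N⁻¹ = −F⁻¹E`, `N′N⁻¹ = E⁻¹K₁ − E⁻¹K₂F⁻¹E`. [folklore] -/
theorem deriv_mul_inv_oneStep {E F : Matrix m m ℂ} (hE : IsUnit E.det) (hF : IsUnit F.det)
    (K₁ K₂ : Matrix m m ℂ) :
    (-(E⁻¹ * K₁ * E⁻¹ * F) + E⁻¹ * K₂) * (-(E⁻¹ * F))⁻¹ = E⁻¹ * K₁ - E⁻¹ * K₂ * F⁻¹ * E := by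
  have hinv : (-(E⁻¹ * F))⁻¹ = -(F⁻¹ * E) := by
    refine Matrix.inv_eq_right_inv ?_
    rw [neg_mul_neg, Matrix.mul_assoc, Matrix.mul_nonsing_inv_cancel_left F _ hF,
      Matrix.nonsing_inv_mul E hE]
  rw [hinv, mul_neg, add_mul, neg_add, neg_mul, neg_neg, Matrix.mul_assoc (E⁻¹ * K₁ * E⁻¹) F,
    Matrix.mul_nonsing_inv_cancel_left F _ hF, Matrix.mul_assoc (E⁻¹ * K₁) E⁻¹ E,
    Matrix.nonsing_inv_mul E hE, Matrix.mul_one, sub_eq_add_neg, Matrix.mul_assoc (E⁻¹ * K₂) F⁻¹ E]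

end StubProjChainDetHasDerivAtSource

open StubProjChainDetHasDerivAtSource in
/-- **E2 F1: the one-slice source derivative of a projector-chain determinant** (general slice
operators; registered stub signature verbatim).  For a `T`-slice Wilson-type projector chain on
`X × Fin N × Fin 4` with slice operators `A_t`, hops `W_t, W′_t` commuting with the lifted time
projections `P± = 1 ⊗ 1 ⊗ ½(1 ± γ₀)`, all `E_t = A_tP⁻ − P⁺W′_{t−1}` invertible and
`F_{t₀} = A_{t₀}P⁺ − P⁻W_{t₀}` invertible, the determinant of the chain with slice operator
`A_{t₀} − sJ` at `t₀` has `s`-derivative at `0`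
`(∏_t det E_t) · STr ∏_{i<T} (𝒥_i Γ(N_i))`, `N_i = −E_i⁻¹F_i`, `𝒥_i = 1` (`i ≠ t₀`),
`𝒥_{t₀} = dΓ(E⁻¹J(P⁻ − P⁺F⁻¹E)) − tr (E⁻¹JP⁻) · 1` (one-particle matrices reindexed to `Fin d`).
Assembly of `det_projChain` with the landed E2 calculus stubs (module docstring).
[cite: Luscher1977, pp. 283–292] -/
theorem stub_projChain_det_hasDerivAt_source :
    ∀ (T : ℕ) [NeZero T] (X : Type) [Fintype X] [DecidableEq X] (N d : ℕ) (e : X × Fin N × Fin 4 ≃ Fin d)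
      (A W W' : ZMod T → Matrix (X × Fin N × Fin 4) (X × Fin N × Fin 4) ℂ) (t₀ : ZMod T)
      (J : Matrix (X × Fin N × Fin 4) (X × Fin N × Fin 4) ℂ),
      let Pp : Matrix (X × Fin N × Fin 4) (X × Fin N × Fin 4) ℂ := Matrix.of fun a b =>
        if a.1 = b.1 ∧ a.2.1 = b.2.1 then ((1 / 2 : ℂ) • (1 + euclideanGamma 0)) a.2.2 b.2.2 else 0;
      let Pm : Matrix (X × Fin N × Fin 4) (X × Fin N × Fin 4) ℂ := Matrix.of fun a b =>
        if a.1 = b.1 ∧ a.2.1 = b.2.1 then ((1 / 2 : ℂ) • (1 - euclideanGamma 0)) a.2.2 b.2.2 else 0;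
      (∀ t, W t * Pp = Pp * W t) → (∀ t, W t * Pm = Pm * W t) →
      (∀ t, W' t * Pp = Pp * W' t) → (∀ t, W' t * Pm = Pm * W' t) →
      (∀ t, IsUnit (A t * Pm - Pp * W' (t - 1)).det) → IsUnit (A t₀ * Pp - Pm * W t₀).det →
      HasDerivAt (fun s : ℝ => (Matrix.of fun p q : ZMod T × (X × Fin N × Fin 4) =>
          (if q.1 = p.1 then (A p.1 - if p.1 = t₀ then (s : ℂ) • J else 0) p.2 q.2 else 0) -
            (if q.1 = p.1 + 1 then (Pm * W p.1) p.2 q.2 else 0) -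
            (if p.1 = q.1 + 1 then (Pp * W' q.1) p.2 q.2 else 0)).det)
        ((∏ t, (A t * Pm - Pp * W' (t - 1)).det) *
          ∑ S : Finset (Fin d), (-1 : ℂ) ^ S.card *
            (((List.range T).map fun i : ℕ =>
              (if (i : ZMod T) = t₀ then
                  dGamma (Matrix.reindex e e ((A t₀ * Pm - Pp * W' (t₀ - 1))⁻¹ * J *
                    (Pm - Pp * (A t₀ * Pp - Pm * W t₀)⁻¹ * (A t₀ * Pm - Pp * W' (t₀ - 1))))) -
                  ((A t₀ * Pm - Pp * W' (t₀ - 1))⁻¹ * J * Pm).trace • (1 : Matrix (Finset (Fin d)) (Finset (Fin d)) ℂ)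
                else 1) *
              fockLift (Matrix.reindex e e (-((A (i : ZMod T) * Pm - Pp * W' ((i : ZMod T) - 1))⁻¹ *
                (A (i : ZMod T) * Pp - Pm * W (i : ZMod T)))))).prod) S S) 0 := by
  intro T _ X _ _ N d e A W W' t₀ J Pp Pm hWp hWm hW'p hW'm hE hF
  -- the two projections as explicit matrices (to fold the output of `det_projChain`)
  have hPp : Pp = Matrix.of fun a b : X × Fin N × Fin 4 =>
      if a.1 = b.1 ∧ a.2.1 = b.2.1 then ((1 / 2 : ℂ) • (1 + euclideanGamma 0)) a.2.2 b.2.2 else 0 := rfl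
  have hPm : Pm = Matrix.of fun a b : X × Fin N × Fin 4 =>
      if a.1 = b.1 ∧ a.2.1 = b.2.1 then ((1 / 2 : ℂ) • (1 - euclideanGamma 0)) a.2.2 b.2.2 else 0 := rfl
  -- the `t₀` slot as a natural number
  have ht₀T : t₀.val < T := ZMod.val_lt t₀
  have hcast : ∀ i, i < T → ((i : ZMod T) = t₀ ↔ i = t₀.val) := fun i hi =>
    ⟨fun h => by rw [← h, ZMod.val_natCast_of_lt hi], fun h => by rw [h, ZMod.natCast_zmod_val]⟩
  -- notation: the `t₀` blocks, the insertion data, the unperturbed factors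
  set E₀ : Matrix (X × Fin N × Fin 4) (X × Fin N × Fin 4) ℂ := A t₀ * Pm - Pp * W' (t₀ - 1)
  set F₀ : Matrix (X × Fin N × Fin 4) (X × Fin N × Fin 4) ℂ := A t₀ * Pp - Pm * W t₀
  set Z : Matrix (X × Fin N × Fin 4) (X × Fin N × Fin 4) ℂ := E₀⁻¹ * J * (Pm - Pp * F₀⁻¹ * E₀) with hZ
  set c : ℂ := (E₀⁻¹ * J * Pm).trace with hc
  set C : ℂ := ∏ t ∈ Finset.univ.erase t₀, (A t * Pm - Pp * W' (t - 1)).det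
  set Mf : ℕ → Matrix (Finset (Fin d)) (Finset (Fin d)) ℂ := fun i =>
    Gamma (Matrix.reindex e e (-((A (i : ZMod T) * Pm - Pp * W' ((i : ZMod T) - 1))⁻¹ *
      (A (i : ZMod T) * Pp - Pm * W (i : ZMod T)))))
  set γ : ℝ → Matrix (Finset (Fin d)) (Finset (Fin d)) ℂ := fun s =>
    Gamma (Matrix.reindex e e (-((E₀ - (s : ℂ) • (J * Pm))⁻¹ * (F₀ - (s : ℂ) • (J * Pp)))))
  have hE₀u : IsUnit E₀.det := hE t₀
  have hMf' : ∀ i : ℕ, Gamma (Matrix.reindex e e (-((A (i : ZMod T) * Pm - Pp * W' ((i : ZMod T) - 1))⁻¹ *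
      (A (i : ZMod T) * Pp - Pm * W (i : ZMod T))))) = Mf i := fun i => rfl
  have hPE : C * E₀.det = ∏ t, (A t * Pm - Pp * W' (t - 1)).det :=
    Finset.prod_erase_mul Finset.univ (fun t => (A t * Pm - Pp * W' (t - 1)).det) (Finset.mem_univ t₀)
  have htr : (E₀⁻¹ * (J * Pm)).trace = c := by rw [hc, Matrix.mul_assoc]
  -- the perturbed `t₀` blocks are affine paths
  have hpE : ∀ s : ℝ, (A t₀ - (s : ℂ) • J) * Pm - Pp * W' (t₀ - 1) = E₀ - (s : ℂ) • (J * Pm) := fun s => by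
    rw [Matrix.sub_mul, Matrix.smul_mul, sub_right_comm]
  have hpF : ∀ s : ℝ, (A t₀ - (s : ℂ) • J) * Pp - Pm * W t₀ = F₀ - (s : ℂ) • (J * Pp) := fun s => by
    rw [Matrix.sub_mul, Matrix.smul_mul, sub_right_comm]
  -- near `s = 0` every perturbed `E`-block is invertible
  have hEall : ∀ s : ℝ, IsUnit (E₀ - (s : ℂ) • (J * Pm)).det →
      ∀ t, IsUnit (((A t - if t = t₀ then (s : ℂ) • J else 0) * Pm - Pp * W' (t - 1)).det) := by
    intro s hs t
    by_cases ht : t = t₀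
    · rw [if_pos ht, ht, hpE]
      exact hs
    · rw [if_neg ht, sub_zero]
      exact hE t
  -- the first factor of `det_projChain` along the path
  have hprod : ∀ s : ℝ, (∏ t, ((A t - if t = t₀ then (s : ℂ) • J else 0) * Pm - Pp * W' (t - 1)).det) =
      C * (E₀ - (s : ℂ) • (J * Pm)).det := fun s => by
    rw [← Finset.prod_erase_mul _ _ (Finset.mem_univ t₀), if_pos rfl, hpE]
    congr 1
    exact Finset.prod_congr rfl fun t ht => by rw [if_neg (Finset.ne_of_mem_erase ht), sub_zero]
  -- the one-step factors along the path: only the slot `t₀.val` moves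
  have hlist : ∀ s : ℝ, ((List.range T).map fun i : ℕ => Gamma (Matrix.reindex e e
      (-(((A (i : ZMod T) - if (i : ZMod T) = t₀ then (s : ℂ) • J else 0) * Pm - Pp * W' ((i : ZMod T) - 1))⁻¹ *
        ((A (i : ZMod T) - if (i : ZMod T) = t₀ then (s : ℂ) • J else 0) * Pp - Pm * W (i : ZMod T)))))) =
      (List.range T).map fun i => if i = t₀.val then γ s else Mf i := fun s => by
    refine List.map_congr_left fun i hi => ?_
    rw [List.mem_range] at hi
    by_cases h : i = t₀.val
    · rw [if_pos h, if_pos ((hcast i hi).2 h), (hcast i hi).2 h, hpE, hpF]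
    · rw [if_neg h, if_neg (mt (hcast i hi).1 h), sub_zero]
  -- the value and the derivative of the moving factor at `s = 0`
  have hM0 : -((E₀ - ((0 : ℝ) : ℂ) • (J * Pm))⁻¹ * (F₀ - ((0 : ℝ) : ℂ) • (J * Pp))) = -(E₀⁻¹ * F₀) := by
    rw [Complex.ofReal_zero, zero_smul, zero_smul, sub_zero, sub_zero]
  have hMf0 : Mf t₀.val = Gamma (Matrix.reindex e e (-(E₀⁻¹ * F₀))) := by
    rw [← hMf', ZMod.natCast_zmod_val]
  have hγ0 : γ 0 = Mf t₀.val := by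
    rw [hMf0]
    exact congrArg (fun M => Gamma (Matrix.reindex e e M)) hM0
  have hZ' : (-(E₀⁻¹ * (J * Pm) * E₀⁻¹ * F₀) + E₀⁻¹ * (J * Pp)) * (-(E₀⁻¹ * F₀))⁻¹ = Z := by
    rw [deriv_mul_inv_oneStep hE₀u hF, hZ, Matrix.mul_sub (E₀⁻¹ * J) Pm (Pp * F₀⁻¹ * E₀),
      Matrix.mul_assoc E₀⁻¹ J Pm, Matrix.mul_assoc E₀⁻¹ J (Pp * F₀⁻¹ * E₀), Matrix.mul_assoc Pp F₀⁻¹ E₀,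
      Matrix.mul_assoc (E₀⁻¹ * (J * Pp)) F₀⁻¹ E₀, Matrix.mul_assoc E₀⁻¹ (J * Pp) (F₀⁻¹ * E₀),
      Matrix.mul_assoc J Pp (F₀⁻¹ * E₀)]
  have hγ₁ : ∀ a b, HasDerivAt
      (fun s : ℝ => Matrix.reindex e e (-((E₀ - (s : ℂ) • (J * Pm))⁻¹ * (F₀ - (s : ℂ) • (J * Pp)))) a b)
      (Matrix.reindex e e (-(E₀⁻¹ * (J * Pm) * E₀⁻¹ * F₀) + E₀⁻¹ * (J * Pp)) a b) 0 := fun a b =>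
    StubOneStepPathHasDerivAt.hasDerivAt_neg_inv_mul_apply F₀ (J * Pm) (J * Pp) hE₀u (e.symm a) (e.symm b)
  have hdet0 : IsUnit (Matrix.reindex e e
      (-((E₀ - ((0 : ℝ) : ℂ) • (J * Pm))⁻¹ * (F₀ - ((0 : ℝ) : ℂ) • (J * Pp))))).det := by
    rw [hM0, Matrix.det_reindex_self]
    exact isUnit_det_neg_inv_mul hE₀u hF
  have hγ' : ∀ S S', HasDerivAt (fun s => γ s S S') ((dGamma (Matrix.reindex e e Z) * Mf t₀.val) S S') 0 := by
    intro S S'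
    have h := StubGammaPathHasDerivAt.hasDerivAt_Gamma_apply_right hγ₁ hdet0 S S'
    rw [hM0, Matrix.inv_reindex, ← FermionSliceOpCovariance.reindex_mul_reindex, hZ', ← hMf0] at h
    exact h
  -- the two scalar paths and their product
  have hP' : HasDerivAt (fun s : ℝ => C * (E₀ - (s : ℂ) • (J * Pm)).det)
      (C * -(E₀.det * (E₀⁻¹ * (J * Pm)).trace)) 0 :=
    (StubMatrixAffinePathCalculus.hasDerivAt_det_sub_smul (J * Pm) hE₀u).const_mul C
  have hQ' := (stub_supertrace_prod_hasDerivAt (Fin d) T t₀.val Mf γ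
    (dGamma (Matrix.reindex e e Z) * Mf t₀.val) 0 hγ' hγ0 ht₀T).2.2
  have hev : ∀ᶠ s : ℝ in nhds 0, IsUnit (E₀ - (s : ℂ) • (J * Pm)).det :=
    StubMatrixAffinePathCalculus.eventually_isUnit_det_sub_smul (J * Pm) hE₀u
  obtain ⟨L, R, hLR⟩ := exists_prod_map_ite_eq Mf ht₀T
  refine ((hP'.fun_mul hQ').congr_of_eventuallyEq ?_).congr_deriv ?_
  · -- near `0` the chain determinant IS the product of the two paths (`det_projChain`)
    filter_upwards [hev] with s hs
    have h := det_projChain T X N (fun t => A t - if t = t₀ then (s : ℂ) • J else 0) W W' hWp hWm hW'p hW'm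
      (hEall s hs)
    rw [← hPp, ← hPm] at h
    rw [h, hprod s, det_one_sub_smul_prod e, hlist s]
  · -- the value of the derivative
    have htarget : ((List.range T).map fun i : ℕ =>
        (if (i : ZMod T) = t₀ then dGamma (Matrix.reindex e e Z) - c • (1 : Matrix (Finset (Fin d)) (Finset (Fin d)) ℂ)
          else 1) * Mf i) =
        (List.range T).map fun i => if i = t₀.val then
          (dGamma (Matrix.reindex e e Z) - c • (1 : Matrix (Finset (Fin d)) (Finset (Fin d)) ℂ)) * Mf t₀.val
          else Mf i := by
      refine List.map_congr_left fun i hi => ?_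
      rw [List.mem_range] at hi
      by_cases h : i = t₀.val
      · rw [if_pos h, if_pos ((hcast i hi).2 h), h]
      · rw [if_neg h, if_neg (mt (hcast i hi).1 h), Matrix.one_mul]
    simp only [FockLiftPosDef.fockLift_eq_Gamma', hMf']
    rw [htarget, hLR, hLR, Complex.ofReal_zero, zero_smul, sub_zero, hγ0, hLR, Matrix.sub_mul,
      Matrix.smul_mul, Matrix.one_mul, Matrix.mul_sub, Matrix.sub_mul, Matrix.mul_smul, Matrix.smul_mul,
      supertrace_sub_smul, ← hPE, htr]
    ring

end Summit.QuantumFields.QCD.Cruxes.RobustYangMillsHandover.PinTheInfimum
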